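import Mathlib
import HarnessLib
import Summits.Ventures.LatticeQCDFlow.Scoring.SelfNormalisedReweightingConsistency

/-!
# The ESS column at `ε = 0`: the PRINTED Kish fraction of one growing proposal stream converges
# almost surely to the population effective sample size — to `1/M₂` when `p²/q ∈ L¹(μ)`, to `0`
# when it is not — with NO moment hypothesis and no ceiling

HONEST FRAMING: exact (Metropolis-corrected) sampling algorithms for lattice gauge theory;
figures of merit are autocorrelation/cost numbers at stated couplings and volumes; no
continuum-physics claim.

Venture `LatticeQCDFlow` (cell pub-lqcd), topic `Scoring`; FANOUT row 4 (`s0-u1-b`, rung S0-B).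
Sequel of `Scoring/SelfNormalisedReweightingConsistency` (imported: the strong law along a stream,
`W̄ₙ → 1`, `F̄ₙ → M₂` or `→ +∞`).  A flow code prints, for its first `n` proposals `yᵢ` with
UNNORMALISED weights `w̃ᵢ = c·p(yᵢ)/q(yᵢ)` (`c = Z` unknown), the Kish fraction
`Kₙ = (Σ_{i<n} w̃ᵢ)² / (n·Σ_{i<n} w̃ᵢ²) ∈ [0, 1]` (`Scoring.kishESS` of `Scoring/PooledESS` over
`range n`, divided by `n`); its population counterpart is `ESS = 1/M₂`, `M₂ = ∫ p²/q dμ = E_q w²`,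
read as `0` when `p²/q ∉ L¹(μ)`.  Row 4's rate certificates for this column need the fourth weight
moment (`Scoring/KishESSCeilingFree`) or a `(2 + 2ε)`-th (`Scoring/KishESSHeavyTail`); here is the
`ε = 0` rung: `Kₙ = W̄ₙ²/F̄ₙ` whatever `c`, and the strong law (finite `M₂`) or Durrett's
infinite-mean strong law (ESS `= 0`, where `F̄ₙ → +∞` while `W̄ₙ → 1`) give almost-sure
convergence to the population ESS in EVERY case, the only inputs being `∫ p dμ = 1` and `q > 0`.
NEW WORK of the cell (elementary); no definition is introduced; nothing is cited as a fact (Kong's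
ESS heuristic, Kong–Liu–Wong, JASA 89 (1994), and Elvira–Martino–Robert, Int. Stat. Rev. 90 (2022)
on its interpretation are NAMED ONLY).

## Content (`ν = μ.withDensity q`; `w = p/q`; `M₂ = ∫ p²/q dμ`; stream `y : ℕ → Ω → X`
## independent with laws `ν`; `Kₙ(ω) = kishESS (range n) (w̃ ∘ y · ω)/n`)

* `kishESS_scale_free` (any finite index set: `w̃ = c·w`, `c ≠ 0`, gives the same Kish value),
  `kishFrac_eq_sq_div_card` (`kishESS s w/#s = (Σw/#s)²/(Σw²/#s)`), `kishFrac_stream_eq`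
  (`Kₙ = W̄ₙ²/F̄ₙ` along the stream, any `c ≠ 0`);
* **`kishFrac_tendsto_ae`** — `p²/q ∈ L¹(μ)` ⇒ `Kₙ → (∫ p²/q dμ)⁻¹ = ESS` almost surely;
* **`kishFrac_tendsto_zero_ae`** — `p²/q ∉ L¹(μ)` ⇒ `Kₙ → 0` almost surely;
* **`kishFrac_tendsto_inv_ae`** — NO integrability hypothesis: `Kₙ → (∫ p²/q dμ)⁻¹` almost
  surely, where Lean's `∫` of a non-integrable function is `0` and `0⁻¹ = 0` — which is exactly the
  population ESS `= 0` of that case, so the single formula is right in both regimes;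
* `kishESS_tendsto_atTop_ae` — finite `M₂`: the absolute printed Kish count `kishESS (range n)`
  tends to `+∞` (it grows like `n/M₂`).

NOT CLAIMED: any rate (the files above); the per-sector / pooled comparison of `Scoring/PooledESS`
along a stream; the chain-side (`τ_int`) column; any number of ours re-scored.
-/

noncomputable section

namespace Summit.Ventures.LatticeQCDFlow.Scoring.CardConsistency

open MeasureTheory ProbabilityTheory Finset Real Filter
open scoped Topology Function

/-! ## §1 Deterministic: scale-freeness and `K = W̄²/F̄` on any finite index set -/

section Deterministic

variable {ι : Type*}

/-- **The Kish value is scale-free** on any finite index set: `kishESS s (c·w) = kishESS s w` for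
`c ≠ 0`. [ours] -/
theorem kishESS_scale_free (s : Finset ι) (w : ι → ℝ) {c : ℝ} (hc : c ≠ 0) :
    kishESS s (fun i => c * w i) = kishESS s w := by
  unfold kishESS
  have e1 : ∑ i ∈ s, c * w i = c * ∑ i ∈ s, w i := by rw [Finset.mul_sum]
  have e2 : ∑ i ∈ s, (c * w i) ^ 2 = c ^ 2 * ∑ i ∈ s, w i ^ 2 := by
    rw [Finset.mul_sum]
    exact Finset.sum_congr rfl fun i _ => by rw [mul_pow]
  rw [e1, e2, mul_pow]
  rcases eq_or_ne (∑ i ∈ s, w i ^ 2) 0 with h | h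
  · simp [h]
  · rw [mul_div_mul_left _ _ (pow_ne_zero 2 hc)]

/-- **The Kish fraction is the squared mean over the mean square**:
`kishESS s w/#s = (Σw/#s)²/(Σw²/#s)` (Lean's `x/0 = 0` conventions agree on both sides). [ours] -/
theorem kishFrac_eq_sq_div_card (s : Finset ι) (w : ι → ℝ) :
    kishESS s w / s.card = ((∑ i ∈ s, w i) / s.card) ^ 2 / ((∑ i ∈ s, w i ^ 2) / s.card) := by
  unfold kishESS
  rcases eq_or_ne (s.card : ℝ) 0 with hm | hm
  · simp [hm]
  rcases eq_or_ne (∑ i ∈ s, w i ^ 2) 0 with h | h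
  · simp [h]
  field_simp

/-- **Along the stream, `Kₙ = W̄ₙ²/F̄ₙ`** for weights printed with any normalisation `w̃ = c·p/q`,
`c ≠ 0`. [ours] -/
theorem kishFrac_stream_eq {X Ω : Type*} {p q wt : X → ℝ} {c : ℝ} (hc : c ≠ 0)
    (hwt : ∀ z, wt z = c * (p z / q z)) (y : ℕ → Ω → X) (ω : Ω) (n : ℕ) :
    kishESS (range n) (fun i => wt (y i ω)) / n
      = ((∑ i ∈ range n, p (y i ω) / q (y i ω)) / n) ^ 2
          / ((∑ i ∈ range n, (p (y i ω) / q (y i ω)) ^ 2) / n) := by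
  have e : (fun i => wt (y i ω)) = fun i => c * (p (y i ω) / q (y i ω)) := funext fun i => hwt _
  have h := kishFrac_eq_sq_div_card (range n) (fun i => p (y i ω) / q (y i ω))
  rw [card_range] at h
  rw [e, kishESS_scale_free (range n) (fun i => p (y i ω) / q (y i ω)) hc]
  exact h

end Deterministic

/-! ## §2 The ESS column of one proposal stream is strongly consistent -/

section Model

variable {Ω : Type*} [MeasurableSpace Ω] {P : Measure Ω} [IsProbabilityMeasure P]
variable {X : Type*} [MeasurableSpace X] {μ : Measure X} {p q : X → ℝ} {y : ℕ → Ω → X}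

/-- **THE PRINTED KISH FRACTION IS STRONGLY CONSISTENT FOR THE ESS (finite `M₂`).**  One
independent proposal stream `yᵢ` (laws `μ.withDensity q`); `p` measurable, integrable,
`∫ p dμ = 1`, `p²/q ∈ L¹(μ)`; `q > 0` measurable; weights printed with ANY normalisation
`w̃ = c·p/q`, `c ≠ 0`.  Then almost surely `Kₙ = kishESS(w̃(y₀), …, w̃(y_{n−1}))/n → (∫ p²/q dμ)⁻¹`
(`= ESS = 1/M₂`). [ours] -/
theorem kishFrac_tendsto_ae (hym : ∀ j, Measurable (y j)) (hind : iIndepFun y P)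
    (hlaw : ∀ j, Measure.map (y j) P = μ.withDensity fun z => ENNReal.ofReal (q z))
    (hpm : Measurable p) (hpi : Integrable p μ) (hp1 : ∫ z, p z ∂μ = 1) (hq0 : ∀ z, 0 < q z)
    (hqm : Measurable q) (hM2i : Integrable (fun z => p z ^ 2 / q z) μ) {wt : X → ℝ} {c : ℝ}
    (hc : c ≠ 0) (hwt : ∀ z, wt z = c * (p z / q z)) :
    ∀ᵐ ω ∂P, Tendsto (fun n : ℕ => kishESS (range n) (fun i => wt (y i ω)) / n) atTop
      (𝓝 (∫ z, p z ^ 2 / q z ∂μ)⁻¹) := by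
  haveI hν : IsProbabilityMeasure (μ.withDensity fun z => ENNReal.ofReal (q z)) := by
    rw [← hlaw 0]
    exact Measure.isProbabilityMeasure_map (hym 0).aemeasurable
  have hM2 : (∫ z, p z ^ 2 / q z ∂μ) ≠ 0 :=
    (one_pos.trans_le (KishESSMedian.one_le_secondMoment_model hν hpm hpi hp1 hq0 hqm hM2i)).ne'
  filter_upwards [meanWeight_tendsto_one_ae hym hind hlaw hpm hpi hp1 hq0 hqm,
    sqWeightMean_tendsto_ae hym hind hlaw hpm hq0 hqm hM2i] with ω hW hF
  have h := (hW.pow 2).div hF hM2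
  rw [one_pow, one_div] at h
  refine h.congr' (Eventually.of_forall fun n => ?_)
  exact (kishFrac_stream_eq hc hwt y ω n).symm

/-- **ESS `= 0`: THE PRINTED KISH FRACTION TENDS TO `0`.**  Same stream and model, but
`p²/q ∉ L¹(μ)` (infinite second weight moment): almost surely `Kₙ → 0` (`W̄ₙ → 1` while
`F̄ₙ → +∞`). [ours] -/
theorem kishFrac_tendsto_zero_ae (hym : ∀ j, Measurable (y j)) (hind : iIndepFun y P)
    (hlaw : ∀ j, Measure.map (y j) P = μ.withDensity fun z => ENNReal.ofReal (q z))
    (hpm : Measurable p) (hpi : Integrable p μ) (hp1 : ∫ z, p z ∂μ = 1) (hq0 : ∀ z, 0 < q z)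
    (hqm : Measurable q) (hM2i : ¬ Integrable (fun z => p z ^ 2 / q z) μ) {wt : X → ℝ} {c : ℝ}
    (hc : c ≠ 0) (hwt : ∀ z, wt z = c * (p z / q z)) :
    ∀ᵐ ω ∂P, Tendsto (fun n : ℕ => kishESS (range n) (fun i => wt (y i ω)) / n) atTop
      (𝓝 0) := by
  filter_upwards [meanWeight_tendsto_one_ae hym hind hlaw hpm hpi hp1 hq0 hqm,
    sqWeightMean_tendsto_atTop_ae hym hind hlaw hpm hq0 hqm hM2i] with ω hW hF
  have h := (hW.pow 2).div_atTop hF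
  refine h.congr' (Eventually.of_forall fun n => ?_)
  exact (kishFrac_stream_eq hc hwt y ω n).symm

/-- **THE ESS COLUMN AT `ε = 0`, ONE FORMULA FOR BOTH REGIMES.**  With NO integrability hypothesis
on `p²/q`: almost surely `Kₙ → (∫ p²/q dμ)⁻¹`.  When `p²/q ∈ L¹(μ)` this is `1/M₂ = ESS`; when it
is not, Lean's `∫ p²/q dμ = 0` and `0⁻¹ = 0` make the right side `0` — the population ESS of that
case — so the statement is the honest one in both regimes. [ours] -/
theorem kishFrac_tendsto_inv_ae (hym : ∀ j, Measurable (y j)) (hind : iIndepFun y P)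
    (hlaw : ∀ j, Measure.map (y j) P = μ.withDensity fun z => ENNReal.ofReal (q z))
    (hpm : Measurable p) (hpi : Integrable p μ) (hp1 : ∫ z, p z ∂μ = 1) (hq0 : ∀ z, 0 < q z)
    (hqm : Measurable q) {wt : X → ℝ} {c : ℝ} (hc : c ≠ 0) (hwt : ∀ z, wt z = c * (p z / q z)) :
    ∀ᵐ ω ∂P, Tendsto (fun n : ℕ => kishESS (range n) (fun i => wt (y i ω)) / n) atTop
      (𝓝 (∫ z, p z ^ 2 / q z ∂μ)⁻¹) := by
  by_cases hM2i : Integrable (fun z => p z ^ 2 / q z) μ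
  · exact kishFrac_tendsto_ae hym hind hlaw hpm hpi hp1 hq0 hqm hM2i hc hwt
  · rw [integral_undef hM2i, inv_zero]
    exact kishFrac_tendsto_zero_ae hym hind hlaw hpm hpi hp1 hq0 hqm hM2i hc hwt

/-- **Finite `M₂`: the absolute printed Kish count grows without bound** (`kishESS(range n) =
n·Kₙ` with `Kₙ → 1/M₂ > 0`). [ours] -/
theorem kishESS_tendsto_atTop_ae (hym : ∀ j, Measurable (y j)) (hind : iIndepFun y P)
    (hlaw : ∀ j, Measure.map (y j) P = μ.withDensity fun z => ENNReal.ofReal (q z))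
    (hpm : Measurable p) (hpi : Integrable p μ) (hp1 : ∫ z, p z ∂μ = 1) (hq0 : ∀ z, 0 < q z)
    (hqm : Measurable q) (hM2i : Integrable (fun z => p z ^ 2 / q z) μ) {wt : X → ℝ} {c : ℝ}
    (hc : c ≠ 0) (hwt : ∀ z, wt z = c * (p z / q z)) :
    ∀ᵐ ω ∂P, Tendsto (fun n : ℕ => kishESS (range n) (fun i => wt (y i ω))) atTop atTop := by
  haveI hν : IsProbabilityMeasure (μ.withDensity fun z => ENNReal.ofReal (q z)) := by
    rw [← hlaw 0]
    exact Measure.isProbabilityMeasure_map (hym 0).aemeasurable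
  have hM2 : 0 < (∫ z, p z ^ 2 / q z ∂μ)⁻¹ :=
    inv_pos.2 (one_pos.trans_le
      (KishESSMedian.one_le_secondMoment_model hν hpm hpi hp1 hq0 hqm hM2i))
  filter_upwards [kishFrac_tendsto_ae hym hind hlaw hpm hpi hp1 hq0 hqm hM2i hc hwt] with ω hK
  -- `kishESS = n · Kₙ` for `n ≥ 1`, and `n · Kₙ → +∞`
  have h : Tendsto (fun n : ℕ => (n : ℝ) * (kishESS (range n) (fun i => wt (y i ω)) / n)) atTop
      atTop :=
    Tendsto.atTop_mul_pos hM2 tendsto_natCast_atTop_atTop hK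
  refine h.congr' ?_
  filter_upwards [eventually_ge_atTop 1] with n hn
  have hn0 : (n : ℝ) ≠ 0 := by exact_mod_cast (show n ≠ 0 by omega)
  rw [mul_div_cancel₀ _ hn0]

end Model

end Summit.Ventures.LatticeQCDFlow.Scoring.CardConsistency

end
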